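import Summits.CriticalPhenomena.Ising3DConformalLimit.Theses.FKParityRobustness
import Summits.CriticalPhenomena.Ising3DConformalLimit.Theorems.FKParityRobustnessDefs
import Summits.CriticalPhenomena.Ising3DConformalLimit.Theorems.FKParityRobustnessFarMergingGivesU4
import Literature.Probability.LatticeModels.CriticalCorrWellDefined
import Literature.Probability.LatticeModels.IsingTransport

/-!
# Skeleton line `closed-cone-limit-twice` for crux `JoinForcesU4` (stmt-CriticalPhenomena-14627)

Route `FKParityRobustness` (sub-problem `Ising3DConformalLimit`), crux r6 (BRIDGE)
`JoinForcesU4 : IndependentStrandsJoin → ∀ ρ S, (0 < ρ on (0,1]) → HasPointwiseScalingLimit (criticalCorr 3) ρ S →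
IsNondegenerateTwoPoint S → HasNontrivialU4 S`.

THE LINE (idea card `Cruxes/JoinForcesU4/Ideas/closed-cone-limit-twice.md`, triage r1-1 / r1-2: pass).  One polynomial
defect `Φ_c(u; g) = u − (g₀₁g₂₃ + g₀₂g₁₃ + g₀₃g₁₂) + c·g₀₁g₂₃` is continuous and bihomogeneous, so `{Φ_c ≤ 0}` is a
CLOSED CONE: it passes to the limit of any convergent 7-tuple along any non-trivial filter.  The bridge has exactly
two limit passages and both transport this one inequality:

* (B) `N → ∞` in the free box `Λ_N ⊂ ℤ³`: K1 (`IndependentStrandsJoin`) at `N ≥ max N₀ l` and the finite-graph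
  Aizenman-type inequality (A) = route item `StrandsJoinBound` (14647, hypothesis `hA` of the composition, by name)
  give, on the INDUCED box graph `(zdGraph 3).comap Subtype.val`, the defect inequality
  `U₄ ≤ −2c·⟨σσ⟩⟨σσ⟩` (`stub_defectOfJoin`: `⟨σ_xσ_y⟩^free = Z^{xy}_t/Z^∅_t`, `Z^∅_t > 0`); the free measure
  of the induced graph on `↥Λ` has the moments of the free finite-volume measure of `ℤ^d` in `Λ`
  (`stub_boxTransport`, Friedli–Velenik §3.1); and the seven free box limits at `β_c`
  (`criticalCorr_wellDefined_holds`, `3 ≤ d`, ADS 2015 continuity — in tree, proved) carry the closed cone to the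
  critical state: `stub_boxLimitCone` ⟹ the tetrahedral lattice bound `U₄^crit(l•tetra) ≤ −2c⟨σσ⟩⟨σσ⟩` for every
  `l ≥ 1` (= `tetraBound (2c) l` of `Negative/LoadBearing.lean`, = the summand of `LatticeBoundFromStrands`).
* (C) `L → ∞` along the mesh `δ_L = L⁻¹` (lattice approximation EXACT on integer points, the same closed cone on
  the sub-sequence of good scales, strictness from non-degeneracy): LANDED —
  `Theorems/FKParityRobustnessFarMergingGivesU4.lean` (item 4471, `farMergingGivesU4_proof`) and, in the form used
  below, `Theorems/JoinForcesU4/Negative/LoadBearing.lean` (`hasNontrivialU4_of_tetraBound_io` =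
  `farMerging_gives_U4 3` at the shape `tetra`).

So the open content of this line is (B), cut into THREE registered stubs (all dimension-free / finite-graph
statements, true in every `d`; the `d = 3` input of the crux is K1 alone — Disproof §D), and the composition
`JoinForcesU4_of` is real: K1 instantiated at `a i = ⟨l • tetra i, _⟩ ∈ box 3 N` for `N ≥ max N₀ l`, (A) on the
induced graph, `stub_defectOfJoin`, transport, `stub_boxLimitCone` (at `d = 3`, `x = l • tetra`, constant `2c`),
then the landed step (C).

EVERY STUB ALREADY HAS A KERNEL-CHECKED PROOF against the live route module, in the crux work-file
`Cruxes/JoinForcesU4/CandidateProof_JoinForcesU4.lean` (crux-ideate k=2; re-checked rc 0 / 0 sorry / axioms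
{propext, Classical.choice, Quot.sound} by both triagers): `stub_boxTransport` = `connectedFour_boxComap` +
`twoPoint_boxComap`; `stub_defectOfJoin` = `defect_of_join` (with `twoPoint_eq_loopO1_div`,
`ecurrentSum_eq_ofReal_loopO1`); `stub_boxLimitCone` = the tail of `latticeBoundShape_holds`
(`tetraDefect_le_of_tendsto'` + `criticalCorr_wellDefined_holds (d := 3) le_rfl` ×7, with `nPoint_isingMeasure` /
`isingExpect_spinMonomial_two` to pass between `connectedFour`/`twoPoint` and `isingExpect … (spinMonomial _)`);
and `hA` = `strandsJoinBoundShape_holds` (item 14647, to be landed `--workitem stmt-CriticalPhenomena-14647`).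
The lead's job is a PORT: land each block under `Theorems/` with `--supports stmt-CriticalPhenomena-14627`
(stub name + signature as registered here), land 14647, then propose this file sorry-free `--workitem`.

## Disproof used (`Cruxes/JoinForcesU4/Disproof.lean`, cdisprove cycle 1; its landed part is
## `Theorems/JoinForcesU4/Negative/LoadBearing.lean` — read in full; NOT imported only because the farm served it
## `unbuilt` at check time (2026-08-16T06Z); nothing below depends on it)

* `withoutNondegeneracy_iff_not_strandsJoin`, `withoutLimit_iff_not_strandsJoin` (ND and the lattice → continuum
  limit are load-bearing): honoured — both enter in step (C), `hasNontrivialU4_of_tetraBound_io … hlim hnd`, and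
  nowhere else; no stub drops them.
* `iff_withoutPositivity` (`0 < ρ` is cosmetic): honoured — `_hρ` is unused by the composition (bihomogeneity
  `ρ⁴ ≥ 0` for every real `ρ`, the card's `tetraDefect_rescale`).
* `not_crux_iff` / `crux_of_supports` / `not_crux_imp_not_support`: the composition IS `crux_of_supports` with the
  second support (`LatticeBoundFromStrands`, 14648) opened up into T/D/L; a refutation of the crux would refute a
  provable-now stub.
* §C.4 `not_loopAizenmanAllT` (the (A)-inequality is FALSE for a free weight `t > 1`; `t = tanh β ≤ 1` is
  load-bearing): concerns `hA` only; `stub_defectOfJoin` is pure algebra GIVEN the two inequalities and holds for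
  every `β ≥ 0`.
* §D `not_farMergingAt_of_exists_limit` (`d ≥ 5`): the three stubs are dimension-uniform and TRUE in every `d`; in
  `d ≥ 5` the same chain refutes K1_d — consistent, the `d = 3` content is the crux hypothesis K1.
* Negative lemmas landed for this crux: `LoadBearing.lean` only (no statement-level refutation); no stub is an
  instance of anything refuted there.  `ledger negatives --problem CriticalPhenomena`: 9 unrelated statements.
-/

noncomputable section

open Filter Topology
open Literature.Probability.LatticeModels
open Summit.CriticalPhenomena.Ising3DConformalLimit.Theses.FKParityRobustness
open Summit.CriticalPhenomena.Ising3DConformalLimit.Cruxes.ParityRobustMerging.PlaquetteXorSurgery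
  (tetra tetra_inj tetra_injective)

namespace Summit.CriticalPhenomena.Ising3DConformalLimit.Cruxes.JoinForcesU4.ClosedConeLimitTwice

/-! ### The stub STATEMENTS (named `Prop`s; the registered `stub_*` theorems restate them verbatim and
`Registered.stub_*` are their name-keyed aliases, the hypotheses of `JoinForcesU4_of`) -/

/-- Statement of STUB T (free-measure TRANSPORT along the box embedding, Friedli–Velenik 2017 §3.1): for a finite
volume `Λ ⊂ ℤ^d`, the free Ising measure of the nearest-neighbour graph INDUCED on `↥Λ`
(`(zdGraph d).comap Subtype.val`, the crux's `G_N` for `Λ = box 3 N`) has the same four-point Ursell combination and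
the same two-point functions as the free finite-volume measure `⟨·⟩^∅_{Λ;β,0}` of `ℤ^d` — whose box limits
`criticalCorr_wellDefined_holds` controls.  Tree tools: `isingExpect_free_map`, `isingTwoPoint_free_map`,
`spinAt_extendAlong`, `measurable_spinMonomial`, `Finset.univ_eq_attach` + `Finset.attach_map_val`. -/
def BoxTransport : Prop :=
  ∀ (d : ℕ) (Λ : Finset (Site d)) (β : ℝ) (a : Fin 4 → ↥Λ),
    connectedFour (isingMeasure ((zdGraph d).comap (Subtype.val : ↥Λ → Site d)) Finset.univ β 0 .free) spinAt a =
        connectedFour (isingMeasure (zdGraph d) Λ β 0 .free) spinAt (fun i => (a i : Site d)) ∧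
      ∀ i j : Fin 4,
        twoPoint (isingMeasure ((zdGraph d).comap (Subtype.val : ↥Λ → Site d)) Finset.univ β 0 .free) spinAt
            (a i) (a j) =
          twoPoint (isingMeasure (zdGraph d) Λ β 0 .free) spinAt (a i : Site d) (a j : Site d)

/-- Statement of STUB D (the DEFECT inequality from a joint-strand bound, every finite graph, every `β ≥ 0`):
if `c·Z^{a₀a₁}_t·Z^{a₂a₃}_t ≤ J` (K1-shape) and `U₄(a)·(Z^∅_t)² ≤ −2J` ((A)-shape, `t = tanh β`), then
`U₄(a) ≤ −2c·⟨σ_{a₀}σ_{a₁}⟩⟨σ_{a₂}σ_{a₃}⟩` for the free measure.  Content: the high-temperature-expansion ratio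
`⟨σ_xσ_y⟩^free_G = Z^{xy}_t / Z^∅_t` (`x ≠ y`, from injectivity) and `Z^∅_t > 0`
(`loopO1PartitionFunction_empty_pos`); in the tree via `isingTwoPoint_free_eq_currentSum_div_holds` +
`tsum_sources_eweight_mul_apply_oddPart` (currents ↔ loop O(1)), or `isingCorr_free_eq_hteSum_div`. -/
def DefectOfJoin : Prop :=
  ∀ (V : Type) [Fintype V] [DecidableEq V] (G : SimpleGraph V) [DecidableRel G.Adj] (β : ℝ), 0 ≤ β →
    ∀ a : Fin 4 → V, Function.Injective a → ∀ c J : ℝ,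
      c * loopO1PartitionFunction G (Real.tanh β) {a 0, a 1} * loopO1PartitionFunction G (Real.tanh β) {a 2, a 3}
          ≤ J →
      connectedFour (isingMeasure G Finset.univ β 0 .free) spinAt a *
          (loopO1PartitionFunction G (Real.tanh β) ∅) ^ 2 ≤ -(2 * J) →
      connectedFour (isingMeasure G Finset.univ β 0 .free) spinAt a ≤
        -(2 * c * (twoPoint (isingMeasure G Finset.univ β 0 .free) spinAt (a 0) (a 1) *
          twoPoint (isingMeasure G Finset.univ β 0 .free) spinAt (a 2) (a 3)))

/-- Statement of STUB L (the CLOSED CONE under the thermodynamic limit, `d ≥ 3`): if the free-box defect inequality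
`U₄^∅_{Λ_N}(x) ≤ −c·⟨σ_{x₀}σ_{x₁}⟩^∅_{Λ_N}⟨σ_{x₂}σ_{x₃}⟩^∅_{Λ_N}` at `β_c(d)` holds for all large `N`, then the
critical state satisfies `U₄^crit(x) ≤ −c·⟨σ_{x₀}σ_{x₁}⟩_{β_c}⟨σ_{x₂}σ_{x₃}⟩_{β_c}` (normal form of `tetraBound` /
`FarMergingGivesU4`).  Content: the seven free box limits `criticalCorr_wellDefined_holds hd n x .free` (`n = 4` and
the six pairs; ADS 2015 continuity at `β_c`, proved in tree), `nPoint_isingMeasure` / `twoPoint_eq_nPoint` to read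
`connectedFour`/`twoPoint` as `isingExpect … (spinMonomial _)`, and `le_of_tendsto_of_tendsto` (the cone is closed). -/
def BoxLimitCone : Prop :=
  ∀ (d : ℕ), 3 ≤ d → ∀ (x : Fin 4 → Site d) (c : ℝ),
    (∀ᶠ N : ℕ in atTop,
      connectedFour (isingMeasure (zdGraph d) (box d N) (criticalBeta d) 0 .free) spinAt x ≤
        -(c * (twoPoint (isingMeasure (zdGraph d) (box d N) (criticalBeta d) 0 .free) spinAt (x 0) (x 1) *
          twoPoint (isingMeasure (zdGraph d) (box d N) (criticalBeta d) 0 .free) spinAt (x 2) (x 3)))) →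
    criticalCorr d 4 x -
        (criticalCorr d 2 ![x 0, x 1] * criticalCorr d 2 ![x 2, x 3] +
          criticalCorr d 2 ![x 0, x 2] * criticalCorr d 2 ![x 1, x 3] +
          criticalCorr d 2 ![x 0, x 3] * criticalCorr d 2 ![x 1, x 2]) ≤
      -(c * (criticalCorr d 2 ![x 0, x 1] * criticalCorr d 2 ![x 2, x 3]))

/-! ### The registered stubs (`sorry` lives ONLY here) -/

/-- STUB T (S/M) — `BoxTransport`: free measure of the induced graph on `↥Λ` = free finite-volume measure of `ℤ^d`
in `Λ`, on `connectedFour` and `twoPoint` (Friedli–Velenik 2017, §3.1: free b.c. = the model on the induced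
subgraph).  Kernel-checked twin: `connectedFour_boxComap`, `twoPoint_boxComap` (CandidateProof_JoinForcesU4.lean). -/
theorem stub_boxTransport :
    ∀ (d : ℕ) (Λ : Finset (Site d)) (β : ℝ) (a : Fin 4 → ↥Λ),
      connectedFour (isingMeasure ((zdGraph d).comap (Subtype.val : ↥Λ → Site d)) Finset.univ β 0 .free) spinAt a =
          connectedFour (isingMeasure (zdGraph d) Λ β 0 .free) spinAt (fun i => (a i : Site d)) ∧
        ∀ i j : Fin 4,
          twoPoint (isingMeasure ((zdGraph d).comap (Subtype.val : ↥Λ → Site d)) Finset.univ β 0 .free) spinAt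
              (a i) (a j) =
            twoPoint (isingMeasure (zdGraph d) Λ β 0 .free) spinAt (a i : Site d) (a j : Site d) := by
  sorry

/-- STUB D (M) — `DefectOfJoin`: on every finite graph at `β ≥ 0`, for injective `a` and reals `c, J`,
`c·Z^{a₀a₁}·Z^{a₂a₃} ≤ J` and `U₄(a)·(Z^∅)² ≤ −2J` give `U₄(a) ≤ −2c·⟨σ_{a₀}σ_{a₁}⟩⟨σ_{a₂}σ_{a₃}⟩`
(`⟨σ_xσ_y⟩^free = Z^{xy}_{tanh β}/Z^∅_{tanh β}`, Aizenman 1982 / HT expansion; `Z^∅ > 0`).  Kernel-checked twin: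
`defect_of_join` (CandidateProof_JoinForcesU4.lean). -/
theorem stub_defectOfJoin :
    ∀ (V : Type) [Fintype V] [DecidableEq V] (G : SimpleGraph V) [DecidableRel G.Adj] (β : ℝ), 0 ≤ β →
      ∀ a : Fin 4 → V, Function.Injective a → ∀ c J : ℝ,
        c * loopO1PartitionFunction G (Real.tanh β) {a 0, a 1} * loopO1PartitionFunction G (Real.tanh β) {a 2, a 3}
            ≤ J →
        connectedFour (isingMeasure G Finset.univ β 0 .free) spinAt a *
            (loopO1PartitionFunction G (Real.tanh β) ∅) ^ 2 ≤ -(2 * J) →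
        connectedFour (isingMeasure G Finset.univ β 0 .free) spinAt a ≤
          -(2 * c * (twoPoint (isingMeasure G Finset.univ β 0 .free) spinAt (a 0) (a 1) *
            twoPoint (isingMeasure G Finset.univ β 0 .free) spinAt (a 2) (a 3))) := by
  sorry

/-- STUB L (M, LOAD-BEARING for this line) — `BoxLimitCone`: the closed cone `{Φ_c ≤ 0}` passes through the
thermodynamic limit of the free box state at `β_c(d)`, `d ≥ 3` (seven box limits `criticalCorr_wellDefined_holds`,
free b.c.; Friedli–Velenik Thm. 3.17/3.28 + Aizenman–Duminil-Copin–Sidoravicius 2015 continuity, all proved in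
tree; then `le_of_tendsto_of_tendsto`).  Kernel-checked twin: the tail of `latticeBoundShape_holds` with
`tetraDefect_le_of_tendsto'` (CandidateProof_JoinForcesU4.lean). -/
theorem stub_boxLimitCone :
    ∀ (d : ℕ), 3 ≤ d → ∀ (x : Fin 4 → Site d) (c : ℝ),
      (∀ᶠ N : ℕ in atTop,
        connectedFour (isingMeasure (zdGraph d) (box d N) (criticalBeta d) 0 .free) spinAt x ≤
          -(c * (twoPoint (isingMeasure (zdGraph d) (box d N) (criticalBeta d) 0 .free) spinAt (x 0) (x 1) *
            twoPoint (isingMeasure (zdGraph d) (box d N) (criticalBeta d) 0 .free) spinAt (x 2) (x 3)))) →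
      criticalCorr d 4 x -
          (criticalCorr d 2 ![x 0, x 1] * criticalCorr d 2 ![x 2, x 3] +
            criticalCorr d 2 ![x 0, x 2] * criticalCorr d 2 ![x 1, x 3] +
            criticalCorr d 2 ![x 0, x 3] * criticalCorr d 2 ![x 1, x 2]) ≤
        -(c * (criticalCorr d 2 ![x 0, x 1] * criticalCorr d 2 ![x 2, x 3])) := by
  sorry

/-! ### Consistency: each named statement IS its registered stub (definitionally) -/

theorem boxTransport_holds : BoxTransport := stub_boxTransport
theorem defectOfJoin_holds : DefectOfJoin := stub_defectOfJoin
theorem boxLimitCone_holds : BoxLimitCone := stub_boxLimitCone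

/-! ### Name-keyed aliases of the open statements (the hypotheses of the composition) -/
namespace Registered

/-- Alias of `BoxTransport` keyed by the registered stub name. -/
abbrev stub_boxTransport : Prop := BoxTransport
/-- Alias of `DefectOfJoin` keyed by the registered stub name. -/
abbrev stub_defectOfJoin : Prop := DefectOfJoin
/-- Alias of `BoxLimitCone` keyed by the registered stub name. -/
abbrev stub_boxLimitCone : Prop := BoxLimitCone

end Registered

/-! ### Sorry-free glue of the composition -/

/-- The dilated tetrahedron `l • tetra` sits in every box of radius `N ≥ l` (`box 3 N = {|x_k| ≤ N}`). -/
theorem smul_tetra_mem_box {l N : ℕ} (h : l ≤ N) (i : Fin 4) : (l : ℤ) • tetra i ∈ box 3 N := by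
  rw [mem_box]
  intro k
  have hl : ((l : ℕ) : ℤ) ≤ N := by exact_mod_cast h
  fin_cases i <;> fin_cases k <;> simp [tetra] <;> omega

/-! ### The composition: (A) by name + the three stubs imply the crux, BY NAME -/

/-- **`JoinForcesU4` from the line** (real proof, no `sorry`).  Hypotheses: the route item `StrandsJoinBound`
(14647, step (A), by name) and the three registered stubs T, D, L.  Given K1 = `IndependentStrandsJoin` with constant
`c`, for every `l ≥ 1`: K1 yields `N₀`; for `N ≥ max N₀ l` put `a i := ⟨l • tetra i, smul_tetra_mem_box⟩`
(injective by `tetra_injective`), apply K1 at `(N, a)` and (A) on the induced box graph at `β_c(3) ≥ 0`, combine by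
D, transport by T — this is the free-box defect inequality with constant `2c`, eventually in `N`; L (at `d = 3`,
`x = l • tetra`) gives the tetrahedral lattice bound with constant `2c` at scale `l`.  Step (C) is the landed
`farMergingGivesU4_proof` (item 4471) at the shape `tetra` along the scales `max L₀ 1`, fed with the limit and
non-degeneracy hypotheses of the crux (`0 < ρ` is only threaded through its unused binder). -/
theorem JoinForcesU4_of (hA : StrandsJoinBound) (hT : Registered.stub_boxTransport)
    (hD : Registered.stub_defectOfJoin) (hL : Registered.stub_boxLimitCone) :
    Summit.CriticalPhenomena.Ising3DConformalLimit.Theses.FKParityRobustness.JoinForcesU4 := by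
  intro hK1 ρ S hρ hlim hnd
  obtain ⟨c, hc, hK⟩ := hK1
  have hβ : 0 ≤ criticalBeta 3 := criticalBeta_nonneg 3
  -- step (B): the tetrahedral lattice bound with constant `2c` at every scale `l ≥ 1`
  have hlat : ∀ l : ℕ, 1 ≤ l →
      criticalCorr 3 4 (fun i => (l : ℤ) • tetra i) -
          (criticalCorr 3 2 ![(l : ℤ) • tetra 0, (l : ℤ) • tetra 1] * criticalCorr 3 2 ![(l : ℤ) • tetra 2, (l : ℤ) • tetra 3] +
            criticalCorr 3 2 ![(l : ℤ) • tetra 0, (l : ℤ) • tetra 2] * criticalCorr 3 2 ![(l : ℤ) • tetra 1, (l : ℤ) • tetra 3] +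
            criticalCorr 3 2 ![(l : ℤ) • tetra 0, (l : ℤ) • tetra 3] * criticalCorr 3 2 ![(l : ℤ) • tetra 1, (l : ℤ) • tetra 2]) ≤
        -(2 * c * (criticalCorr 3 2 ![(l : ℤ) • tetra 0, (l : ℤ) • tetra 1] *
          criticalCorr 3 2 ![(l : ℤ) • tetra 2, (l : ℤ) • tetra 3])) := by
    intro l hl
    obtain ⟨N₀, hN⟩ := hK l hl
    refine hL 3 le_rfl (fun i => (l : ℤ) • tetra i) (2 * c)
      (Filter.eventually_atTop.2 ⟨max N₀ l, fun N hNl => ?_⟩)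
    have hN₀N : N₀ ≤ N := le_of_max_le_left hNl
    have hlN : l ≤ N := le_of_max_le_right hNl
    -- K1's configuration inside the box `Λ_N`
    let a : Fin 4 → ↥(box 3 N) := fun i => ⟨(l : ℤ) • tetra i, smul_tetra_mem_box hlN i⟩
    have ha : ∀ i, ((a i : Site 3)) = (l : ℤ) • tetra i := fun i => rfl
    have hainj : Function.Injective a := tetra_injective hl a ha
    -- K1 at `(N, a)` and (A) on the induced box graph, combined by D
    have h1 := hN N hN₀N a ha
    have h2 := hA ↥(box 3 N) ((zdGraph 3).comap (Subtype.val : ↥(box 3 N) → Site 3)) (criticalBeta 3) hβ a hainj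
    have h3 := hD ↥(box 3 N) ((zdGraph 3).comap (Subtype.val : ↥(box 3 N) → Site 3)) (criticalBeta 3) hβ a hainj
      c _ h1 h2
    -- transport to the free box measure of `ℤ³`
    obtain ⟨h4, h2pt⟩ := hT 3 (box 3 N) (criticalBeta 3) a
    rw [h4, h2pt 0 1, h2pt 2 3] at h3
    exact h3
  -- step (C), landed (item 4471): far merging along the scales `max L₀ 1` of the shape `tetra` forces `U₄^S ≢ 0`
  exact Summit.CriticalPhenomena.Ising3DConformalLimit.FKParityRobustnessFarMergingGivesU4.farMergingGivesU4_proof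
    ⟨2 * c, by positivity, tetra, tetra_inj, fun L₀ => ⟨max L₀ 1, le_max_left _ _, hlat _ (le_max_right _ _)⟩⟩
    ρ S hρ hlim hnd

/-- Wiring check: the registered stubs (and the route item `StrandsJoinBound`, here as a hypothesis) feed
`JoinForcesU4_of` as stated. -/
example (hA : StrandsJoinBound) :
    Summit.CriticalPhenomena.Ising3DConformalLimit.Theses.FKParityRobustness.JoinForcesU4 :=
  JoinForcesU4_of hA stub_boxTransport stub_defectOfJoin stub_boxLimitCone

end Summit.CriticalPhenomena.Ising3DConformalLimit.Cruxes.JoinForcesU4.ClosedConeLimitTwice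

end
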